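import Summits.QuantumFields.YangMills.Theorems.BalabanLadderIRcofEquipartitionSeamCodeHook
import HarnessLib

/-!
# Line `equipartition_seam` (crux `IRcof`, stmt-QuantumFields-26930): the engine in PAIR FORM (adapter toward stub S4ᵛ)

The landed engine `centreFourier_traceBlindness_opNorm` (p666431) compares a twisted sector `x` with the UNTWISTED one:
`‖tr(U_x X A)·tr X − tr(X A)·tr(U_x X)‖ ≤ (2|α|+1)‖A‖ δ (Re tr X)²`.  Stub S4ᵛ (`EBlindUnitOn`) compares TWO electrically related
sectors `z, w` and carries the product of THEIR weights `p_z p_w` on the right.  This file proves the matrix-level adapter: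
for `δ ≤ 1/2`,
`‖tr(U_x X A)·tr(U_y X) − tr(U_y X A)·tr(U_x X)‖ ≤ 12 (2|α|+1)‖A‖ δ · Re tr(U_x X) · Re tr(U_y X)`
(identity `tr X · (T_x t_y − T_y t_x) = t_y ε_x − t_x ε_y` with `ε_x` the engine's defect; `‖t_x‖ ≤ (1+δ) Re tr X`,
`Re t_x ≥ (1−δ) Re tr X`; the degenerate case `tr X = 0` forces `t_x = t_y = 0`).  CLASS: adapter ∕ bookkeeping toward S4ᵛ — NOT a
located lemma; no wall of census row 47 is touched.  HONEST LABEL: the Yang–Mills mass gap (Clay) is NOT proved; `IRcof` ∕ `IR` 0 ∕ 1;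
row 47 class PWP unchanged; nothing continuum ∕ OS ∕ Clay.  Ideator `ym-ir-idea-22` g5, 2026-08-28.
-/

set_option autoImplicit false

noncomputable section

open scoped ComplexOrder MatrixOrder Matrix.Norms.L2Operator
open Matrix
open Summit.QuantumFields.YangMills.Theorems.NonSimplyConnectedLatticeGap

namespace Summit.QuantumFields.YangMills.Cruxes.IRcof.EquipartitionSeam.EnginePair

variable {n : Type} [Fintype n] [DecidableEq n]
variable {α : Type} [AddCommGroup α] [Fintype α] [DecidableEq α]

/-- **The engine in pair form.** -/
theorem centreFourier_traceBlindness_pair (U : α → Matrix n n ℂ) (X A : Matrix n n ℂ) (δ : ℝ)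
    (hU0 : U 0 = 1) (hUadd : ∀ x y : α, U (x + y) = U x * U y) (hUstar : ∀ x : α, (U x)ᴴ = U (-x))
    (hX : X.PosSemidef) (hUX : ∀ x : α, U x * X = X * U x) (hδ : 0 ≤ δ) (hδ1 : δ ≤ 1 / 2)
    (hequi : ∀ x : α, ‖(U x * X).trace - X.trace‖ ≤ δ * X.trace.re) (x y : α) :
    ‖(U x * X * A).trace * (U y * X).trace - (U y * X * A).trace * (U x * X).trace‖
      ≤ 12 * ((2 * (Fintype.card α : ℝ) + 1) * ‖A‖ * δ) * ((U x * X).trace.re * (U y * X).trace.re) := by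
  -- the engine's defects
  have hE := fun z : α => centreFourier_traceBlindness_opNorm U X A δ hU0 hUadd hUstar hX hUX hδ hequi z
  set K : ℝ := (2 * (Fintype.card α : ℝ) + 1) * ‖A‖ * δ with hKdef
  have hK : 0 ≤ K := by rw [hKdef]; positivity
  set t : ℂ := X.trace with htdef
  set tx : ℂ := (U x * X).trace with htxdef
  set ty : ℂ := (U y * X).trace with htydef
  set Tx : ℂ := (U x * X * A).trace with hTxdef
  set Ty : ℂ := (U y * X * A).trace with hTydef
  set T : ℂ := (X * A).trace with hTdef
  -- `tr X` is a nonnegative real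
  have htnn : (0 : ℂ) ≤ t := hX.trace_nonneg
  have htre : 0 ≤ t.re := (Complex.nonneg_iff.1 htnn).1
  have htim : t.im = 0 := (Complex.nonneg_iff.1 htnn).2.symm
  have hteq : t = (t.re : ℂ) := Complex.ext (by simp) (by simp [htim])
  have htnorm : ‖t‖ = t.re := by rw [hteq, Complex.norm_real, Real.norm_of_nonneg htre]; simp
  -- sector traces are comparable to `tr X`
  have hnear : ∀ z : α, ‖(U z * X).trace - t‖ ≤ δ * t.re := fun z => hequi z
  have hnx : ‖tx‖ ≤ (1 + δ) * t.re := by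
    calc ‖tx‖ = ‖(tx - t) + t‖ := by rw [sub_add_cancel]
      _ ≤ ‖tx - t‖ + ‖t‖ := norm_add_le _ _
      _ ≤ δ * t.re + t.re := add_le_add (hnear x) htnorm.le
      _ = (1 + δ) * t.re := by ring
  have hny : ‖ty‖ ≤ (1 + δ) * t.re := by
    calc ‖ty‖ = ‖(ty - t) + t‖ := by rw [sub_add_cancel]
      _ ≤ ‖ty - t‖ + ‖t‖ := norm_add_le _ _
      _ ≤ δ * t.re + t.re := add_le_add (hnear y) htnorm.le
      _ = (1 + δ) * t.re := by ring
  have hrex : t.re / 2 ≤ tx.re := by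
    have h1 : (t - tx).re ≤ ‖t - tx‖ := (le_abs_self _).trans (Complex.abs_re_le_norm _)
    have h2 : ‖t - tx‖ ≤ δ * t.re := by rw [norm_sub_rev]; exact hnear x
    have h3 : (t - tx).re = t.re - tx.re := by simp
    nlinarith
  have hrey : t.re / 2 ≤ ty.re := by
    have h1 : (t - ty).re ≤ ‖t - ty‖ := (le_abs_self _).trans (Complex.abs_re_le_norm _)
    have h2 : ‖t - ty‖ ≤ δ * t.re := by rw [norm_sub_rev]; exact hnear y
    have h3 : (t - ty).re = t.re - ty.re := by simp
    nlinarith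
  -- the algebraic identity behind the pair form
  have hid : t * (Tx * ty - Ty * tx) = ty * (Tx * t - T * tx) - tx * (Ty * t - T * ty) := by ring
  by_cases h0 : t.re = 0
  · -- degenerate case: `tr X = 0` forces `t_x = t_y = 0`
    have ht0 : t = 0 := by rw [hteq, h0]; simp
    have htx0 : tx = 0 := by
      have h := hnear x
      rw [h0, mul_zero, ht0, sub_zero] at h
      exact norm_le_zero_iff.1 h
    have hty0 : ty = 0 := by
      have h := hnear y
      rw [h0, mul_zero, ht0, sub_zero] at h
      exact norm_le_zero_iff.1 h
    rw [htx0, hty0, mul_zero, mul_zero, sub_zero, norm_zero, Complex.zero_re, mul_zero, mul_zero]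
  · have htpos : 0 < t.re := lt_of_le_of_ne htre (Ne.symm h0)
    -- `‖t‖ · ‖pair‖ ≤ ‖t_y‖ E + ‖t_x‖ E`
    have hmain : t.re * ‖Tx * ty - Ty * tx‖ ≤ 2 * ((1 + δ) * t.re) * (K * t.re ^ 2) := by
      have h1 : ‖t * (Tx * ty - Ty * tx)‖ ≤ ‖ty‖ * ‖Tx * t - T * tx‖ + ‖tx‖ * ‖Ty * t - T * ty‖ := by
        rw [hid]
        exact (norm_sub_le _ _).trans (add_le_add (norm_mul_le _ _) (norm_mul_le _ _))
      rw [norm_mul, htnorm] at h1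
      have ex := hE x
      have ey := hE y
      have hb1 : ‖ty‖ * ‖Tx * t - T * tx‖ ≤ ((1 + δ) * t.re) * (K * t.re ^ 2) :=
        mul_le_mul hny (by rw [hKdef]; exact ex) (norm_nonneg _) (by positivity)
      have hb2 : ‖tx‖ * ‖Ty * t - T * ty‖ ≤ ((1 + δ) * t.re) * (K * t.re ^ 2) :=
        mul_le_mul hnx (by rw [hKdef]; exact ey) (norm_nonneg _) (by positivity)
      linarith
    have hpair : ‖Tx * ty - Ty * tx‖ ≤ 3 * K * t.re ^ 2 := by
      have h2 : ‖Tx * ty - Ty * tx‖ ≤ 2 * (1 + δ) * K * t.re ^ 2 := by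
        have h3 : t.re * ‖Tx * ty - Ty * tx‖ ≤ t.re * (2 * (1 + δ) * K * t.re ^ 2) := by nlinarith
        exact le_of_mul_le_mul_left h3 htpos
      have h4 : 2 * (1 + δ) * K * t.re ^ 2 ≤ 3 * K * t.re ^ 2 := by
        have : 0 ≤ K * t.re ^ 2 := by positivity
        nlinarith
      exact h2.trans h4
    -- `(Re tr X)² ≤ 4 · Re t_x · Re t_y`
    have hsq : t.re ^ 2 ≤ 4 * (tx.re * ty.re) := by
      have hx0 : 0 ≤ t.re / 2 := by positivity
      have h := mul_le_mul hrex hrey hx0 ((hx0.trans hrex))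
      nlinarith
    calc ‖Tx * ty - Ty * tx‖ ≤ 3 * K * t.re ^ 2 := hpair
      _ ≤ 3 * K * (4 * (tx.re * ty.re)) := by gcongr
      _ = 12 * K * (tx.re * ty.re) := by ring

end Summit.QuantumFields.YangMills.Cruxes.IRcof.EquipartitionSeam.EnginePair

#print axioms Summit.QuantumFields.YangMills.Cruxes.IRcof.EquipartitionSeam.EnginePair.centreFourier_traceBlindness_pair

end
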